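import Literature.Analysis.ValidatedNumerics.TaylorModelExp
import HarnessLib

/-!
# Taylor model of `ψ₂(u) = (e^{-u} − 1 + u)/u²` and continuity of `φ(u) = (1 − e^{-u})/u` at `0`

Trunk T-ANA (Analysis/ValidatedNumerics); namespace `Literature.Analysis.ValidatedNumerics.PolyMP`.
Sequel of `TaylorModelExp.lean` (`phiExp`, `tphiI`).  The second divided difference of the exponential,

  `ψ₂(u) = (e^{-u} − 1 + u)/u² = Σ_{k≥0} (−u)^k/(k+2)!`   (value `1/2` at `u = 0`; entire),

satisfies `e^{-u} = 1 − u + u² ψ₂(u)` and `φ(u) = 1 − u ψ₂(u)`; it is the ingredient through which quotients such as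
`(e^{-t/2} − φ(2t))/t = −½ + (t/4)ψ₂(t/2) + 2ψ₂(2t)` (the regular part of the tail of the archimedean density of the Weil form near
`0`) become Taylor-modellable WITHOUT a division by the small variable.  Contents: `psi2Exp`, `psi2Coeffs`, the remainder estimate
`abs_psi2Exp_sub_le` (`|ψ₂(u) − Σ_{k<K}(−u)^k/(k+2)!| ≤ |u|^K (K+3)/((K+2)!(K+2))` for `|u| ≤ 1`, from `Real.exp_bound`), the Taylor
model `tpsi2I` with `tmem_psi2`, the identities `exp_neg_eq_psi2`, `phiExp_eq_psi2`, and `abs_phiExp_sub_one_le`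
(`|φ(u) − 1| ≤ ¾|u|`, `|u| ≤ 1`).  Problem-independent; no facts, no axioms.

## References

* The exponential series with remainder (Mathlib `Real.exp_bound`). [folklore]
* K. Makino, M. Berz, Int. J. Pure Appl. Math. 4 (2003) 379–456, §2. [folklore]
-/

namespace Literature.Analysis.ValidatedNumerics

namespace PolyMP

open Literature.Analysis.ValidatedNumerics.NumericsMP
open Literature.Analysis.ValidatedNumerics.ExpPoly (Poly)

/-! ### `ψ₂` and its Taylor expansion -/

/-- `ψ₂(u) = (e^{-u} − 1 + u)/u²`, extended by `1/2` at `u = 0`. [folklore] -/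
noncomputable def psi2Exp (u : ℝ) : ℝ := if u = 0 then 1 / 2 else (Real.exp (-u) - 1 + u) / u ^ 2

/-- `e^{-u} = 1 − u + u² ψ₂(u)`. [folklore] -/
theorem exp_neg_eq_psi2 (u : ℝ) : Real.exp (-u) = 1 - u + u ^ 2 * psi2Exp u := by
  by_cases h : u = 0
  · subst h; simp [psi2Exp]
  · rw [psi2Exp, if_neg h]; field_simp; ring

/-- `φ(u) = 1 − u ψ₂(u)`. [folklore] -/
theorem phiExp_eq_psi2 (u : ℝ) : phiExp u = 1 - u * psi2Exp u := by
  by_cases h : u = 0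
  · subst h; simp [phiExp, psi2Exp]
  · rw [phiExp, if_neg h, exp_neg_eq_psi2]; field_simp; ring

/-- The Taylor coefficients `(−1)^k/(k+2)!`, `k < K`, of `ψ₂`. [folklore] -/
def psi2Coeffs (K : ℕ) : List ℚ := (List.range K).map fun k => (-1) ^ k / ((k + 2).factorial : ℚ)

/-- **Taylor expansion of `ψ₂` with remainder**: for `|u| ≤ 1`,
`|ψ₂(u) − Σ_{k<K} (−u)^k/(k+2)!| ≤ |u|^K (K+3)/((K+2)!(K+2))`. [folklore] -/
theorem abs_psi2Exp_sub_le {u : ℝ} (hu : |u| ≤ 1) (K : ℕ) :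
    |psi2Exp u - Poly.eval (psi2Coeffs K) u| ≤ |u| ^ K * ((K + 3 : ℝ) / (((K + 2).factorial : ℝ) * (K + 2))) := by
  rw [psi2Coeffs, poly_eval_map_range]
  by_cases h0 : u = 0
  · subst h0
    rcases Nat.eq_zero_or_pos K with hK | hK
    · subst hK
      simp [psi2Exp]
      norm_num
    · have : ∑ k ∈ Finset.range K, (((-1 : ℚ) ^ k / ((k + 2).factorial : ℚ) : ℚ) : ℝ) * (0 : ℝ) ^ k = 1 / 2 := by
        rw [Finset.sum_eq_single 0]
        · simp
        · intro k _ hk; simp [hk]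
        · intro h; exact absurd (Finset.mem_range.2 hK) h
      rw [psi2Exp, if_pos rfl, this]
      simp [zero_pow hK.ne']
  · -- exponential series for `e^{-u}` with `K + 2` terms
    have hx : |(-u)| ≤ 1 := by rwa [abs_neg]
    have hrem := Real.exp_bound hx (Nat.succ_pos (K + 1))
    -- split off the terms `j = 0, 1`
    rw [Finset.sum_range_succ', Finset.sum_range_succ'] at hrem
    simp only [pow_zero, Nat.factorial_zero, Nat.cast_one, div_one, zero_add, pow_one, Nat.factorial_one] at hrem
    have hpsi : psi2Exp u = (Real.exp (-u) - 1 + u) / u ^ 2 := by rw [psi2Exp, if_neg h0]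
    have hsum : ∑ k ∈ Finset.range K, (((-1 : ℚ) ^ k / ((k + 2).factorial : ℚ) : ℚ) : ℝ) * u ^ k =
        (∑ k ∈ Finset.range K, (-u) ^ (k + 1 + 1) / ((k + 1 + 1).factorial : ℝ)) / u ^ 2 := by
      rw [Finset.sum_div]
      refine Finset.sum_congr rfl fun k _ => ?_
      push_cast
      rw [neg_pow, show k + 1 + 1 = k + 2 from rfl, pow_add]
      field_simp
      rw [neg_pow]
      ring
    have hkey : psi2Exp u - ∑ k ∈ Finset.range K, (((-1 : ℚ) ^ k / ((k + 2).factorial : ℚ) : ℚ) : ℝ) * u ^ k =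
        (Real.exp (-u) - (∑ k ∈ Finset.range K, (-u) ^ (k + 1 + 1) / ((k + 1 + 1).factorial : ℝ) + -u + 1)) / u ^ 2 := by
      rw [hpsi, hsum]; field_simp; ring
    rw [hkey, abs_div, abs_pow]
    have hupos : 0 < |u| := abs_pos.2 h0
    rw [div_le_iff₀ (by positivity)]
    refine hrem.trans (le_of_eq ?_)
    simp only [abs_neg, Nat.succ_eq_add_one, Nat.factorial_succ, pow_succ]
    push_cast
    ring

/-! ### The Taylor model of `ρ ↦ ψ₂(u(ρ))` -/

/-- Scaled remainder bound for `ψ₂` given a scaled range bound `B` (`|u| S ≤ B`). [folklore] -/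
def tpsi2Rem (S : ℕ) (B : ℤ) (K : ℕ) : ℤ :=
  ⌈(S : ℚ) * (((B : ℚ) / S) ^ K * ((K + 3 : ℚ) / ((((K + 2).factorial : ℕ) : ℚ) * (K + 2))))⌉

/-- The Taylor model of `ρ ↦ ψ₂(u(ρ))`. [folklore] -/
def tpsi2I (S : ℕ) (h : ℚ) (D K : ℕ) (U : IPoly) : IPoly :=
  widen0 (thornerI S h D (psi2Coeffs K) U) (tpsi2Rem S (tabsI S h U) K)

/-- **Soundness of `tpsi2I`.** If `U` encloses `u` on `|ρ| ≤ h` and `tabsI S h U ≤ S` (so `|u| ≤ 1`), then `tpsi2I S h D K U`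
encloses `ρ ↦ ψ₂(u(ρ))`. [folklore] -/
theorem tmem_psi2 {S : ℕ} (hS : 0 < S) {h : ℚ} (h0 : 0 ≤ h) (D K : ℕ) {u : ℝ → ℝ}
    {U : IPoly} (hu : TMem S h u U) (hB : tabsI S h U ≤ S) :
    TMem S h (fun ρ => psi2Exp (u ρ)) (tpsi2I S h D K U) := by
  intro ρ hρ
  obtain ⟨as, has, hev⟩ := tmem_horner hS h0 D hu (psi2Coeffs K) ρ hρ
  have hSr : (0 : ℝ) < S := by exact_mod_cast hS
  have habs := abs_le_tabsI h0 hu hρ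
  have hu1 : |u ρ| ≤ 1 := by
    have : (tabsI S h U : ℝ) ≤ S := by exact_mod_cast hB
    nlinarith
  have huB : |u ρ| ≤ (tabsI S h U : ℝ) / S := by rw [le_div_iff₀ hSr]; exact habs
  set δ : ℝ := psi2Exp (u ρ) - Poly.eval (psi2Coeffs K) (u ρ) with hδ
  have hδle : |δ| * S ≤ (tpsi2Rem S (tabsI S h U) K : ℝ) := by
    have h1 := abs_psi2Exp_sub_le hu1 K
    have h2 : |u ρ| ^ K ≤ ((tabsI S h U : ℝ) / S) ^ K := pow_le_pow_left₀ (abs_nonneg _) huB K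
    have hc : (0 : ℝ) ≤ (K + 3 : ℝ) / (((K + 2).factorial : ℝ) * (K + 2)) := by positivity
    have h3 : |δ| ≤ ((tabsI S h U : ℝ) / S) ^ K * ((K + 3 : ℝ) / (((K + 2).factorial : ℝ) * (K + 2))) :=
      h1.trans (mul_le_mul_of_nonneg_right h2 hc)
    have h4 : ((S : ℚ) * ((((tabsI S h U : ℤ) : ℚ) / S) ^ K *
        ((K + 3 : ℚ) / ((((K + 2).factorial : ℕ) : ℚ) * (K + 2)))) : ℝ) ≤ (tpsi2Rem S (tabsI S h U) K : ℝ) := by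
      unfold tpsi2Rem; exact_mod_cast Int.le_ceil _
    refine le_trans ?_ h4
    push_cast
    nlinarith [h3, abs_nonneg δ, hSr.le]
  obtain ⟨bs, hbs, hev2⟩ := exists_widen0 has hδle ρ
  exact ⟨bs, hbs, by rw [hev2, ← hev, hδ]; ring⟩

/-! ### `φ` near `0` -/

/-- `|φ(u) − 1| ≤ ¾ |u|` for `|u| ≤ 1` (the case `K = 1` of `abs_phiExp_sub_le`). [folklore] -/
theorem abs_phiExp_sub_one_le {u : ℝ} (hu : |u| ≤ 1) : |phiExp u - 1| ≤ 3 / 4 * |u| := by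
  have h := abs_phiExp_sub_le hu Nat.one_pos
  have e : Poly.eval (phiCoeffs 1) u = 1 := by
    simp [phiCoeffs, Poly.eval]
  rw [e] at h
  norm_num [Nat.factorial] at h
  linarith

/-- `φ` is continuous at `0`. [folklore] -/
theorem continuousAt_phiExp_zero : ContinuousAt phiExp 0 := by
  rw [Metric.continuousAt_iff]
  intro ε hε
  refine ⟨min 1 ε, lt_min one_pos hε, fun u hu => ?_⟩
  rw [Real.dist_eq, sub_zero] at hu
  have hu1 : |u| ≤ 1 := (hu.trans_le (min_le_left _ _)).le
  rw [Real.dist_eq, show phiExp 0 = 1 by simp [phiExp]]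
  calc |phiExp u - 1| ≤ 3 / 4 * |u| := abs_phiExp_sub_one_le hu1
    _ < ε := by linarith [hu.trans_le (min_le_right _ _), abs_nonneg u]

end PolyMP

end Literature.Analysis.ValidatedNumerics
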